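import Summits.BirchSwinnertonDyer.BirchSwinnertonDyer.Theorems.AdditiveWildRankOneNonTowerOfConjA
import Summits.BirchSwinnertonDyer.Rank1Residual.Additive.TypeGRamification
import Summits.BirchSwinnertonDyer.Rank1Residual.AdditivePotMult.RankOneHeegner
import HarnessLib

/-!
# KT's residual `TameRankOne` (stmt-BirchSwinnertonDyer-19984) on ALL irreducible (t′) rows — tower onto OR NOT — in the
# item's own binders, and K9's 19200 in its own currency: the twist's r = 0 UPPER half on the NON-tower rows is the cell's
# own aside `TameFineSelmerCoatesSujatha` (19413) / `WildFineSelmerCoatesSujatha` (19386) through Kato's FINE reading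

Prover seat `bsd-potss-kmc`, gen 21 (cell `bsd-potss`; row B8 «O7-ss», tame part = class O5 (t′) at any odd `p`; KT route
`KatoDescentTamePotSupersingular`, residual 19984; K9 route `KatoDescentPotSupersingular`, residual 19200), 2026-08-27.
HONEST FRAMING: CONDITIONAL on every displayed hypothesis; 0 definitions, 0 named facts minted, 0 `sorry`; closes nothing;
BSD_p for no curve. Sequel of `AdditiveWildRankOneNonTowerOfConjA.lean` (same seat, same day), whose §1
`missingUpperBoundAt_twist_of_irreducible_of_fineSelmerDual_fg` (the Heegner twist's r = 0 UPPER half from Coates–Sujatha (A)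
AT THE TWIST, any odd additive potentially good `p`, irreducible image) is instantiated here on the (t′) rows:

* §1 `missingUpperBoundAt_twist_tame_of_coatesSujatha_of_kato` — `Addv W p ∧ SubTprime W p`, `ρ̄_{E,p}` irreducible, ANY
  tower: the twist's UPPER half ⟸ A161″ (tower rows) ∧ [`hCS` := the TEXT of KT's aside 19413 `TameFineSelmerCoatesSujatha`
  VERBATIM + the fine reading] (non-tower non-CM rows; the twist is again (t′), irreducible, non-tower, `r_an = 0` —
  a private re-homing of `subTprime_twist_of_heegner`, whose public module imports the KT route) ∧ the CM triple;
* §2 **`bsdp_tameRankOne_irreducible_of_flatIMCEq_of_coatesSujatha_of_tameLowerHalfRankZero_of_kato_of_facts`** — `BSD_p`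
  on ALL irreducible r = 1 (t′) rows ⟸ IMC♭-eq (RESEARCH: no BDP-IMC at `p² ∣ N` in print) ∧ 19413's text (at the non-tower
  twists) ∧ `hL0` := the TEXT of KT's L₀ 19981 `TameLowerHalfRankZero` (at the twists) ∧ A161″ ∧ fine reading ∧ CM triple ∧
  the seven cohomological facts ∧ Hsieh ∧ LZZ ∧ ToricPublishedInputs; **`missingPPartAt_tameRankOne_irreducible_…`** in
  19984's binders `r_an = 1 → p ≠ 2 → Addv W p → SubTprime W p` (+ `ρ̄` irreducible, row predicate `R`);
* §3 **`missingPPartAt_wildRankOne_irreducible_of_flatIMCEq_of_coatesSujatha_of_wildLowerHalfRankZero_of_kato_of_facts`** —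
  K9's 19200 on ALL irreducible rows in its currency `MissingPPartAt W 3` (corollary of the prequel's `bsdp_wildRankOne_…`).

The routes' files are NOT imported (texts verbatim; a by-name glue check is attached to the items as evidence). The U₀-ns
nodes 19189 / 19202 and their Jetchev roads are NOT used, so there is no circularity with the «TameRankOne at twists» entry
of the U₀ bill. NET for the KT/K9 tenure: on the X4 rank-one rows of O5 (t′) and O6, tower onto or not, the residual items
19984 / 19200 ⟸ ONE analytic statement (IMC♭-eq) + the routes' OWN r = 0 items L₀ (19981 / 19195) and (A) (19413 / 19386,
only at the non-tower twists) + named print.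

References: [Kato2004Asterisque] Thm. 12.5 (3), 13.14, Thm. 14.5 (3), 14.14, Prop. 14.16 (2); [Lim2017FineSelmer] §3;
[CoatesSujatha2005] §3; [GrossZagier1986] I.(6.3), Thm. I.7.3; [JetchevSkinnerWan2017] §7.4.1, Thm. 3.3.1; [Hsieh2014]
Thm A; [LiuZhangZhang2018] Thm 1.5.1/1.5.3; [BurungaleFlach2024] Thm. 1.1, Cor. 2; [Serre1967GroupesPDivisibles] §5 Prop. 8;
[SilvermanATAEC1994] IV.9.4; [Serre1973] Ch. II §3.3 Thm. 3; [Mazur1978] §5.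
-/

noncomputable section

open scoped Classical

set_option linter.dupNamespace false
set_option autoImplicit false

namespace Summit.BirchSwinnertonDyer.BirchSwinnertonDyer.Theorems.UniversalToricDescentWaldspurgerFlat

open WeierstrassCurve NumberField IsDedekindDomain IsDedekindDomain.HeightOneSpectrum Field PowerSeries
  Rat.HeightOneSpectrum
  Literature.NumberTheory.EllipticCurves
  Literature.NumberTheory.EllipticCurves.ModularForms
  Literature.NumberTheory.DiophantineGeometry
  Literature.NumberTheory.EllipticCurves.Rank1Residual
  Literature.NumberTheory.EllipticCurves.Rank1Residual.Typed
  Literature.NumberTheory.Automorphic Literature.NumberTheory.EllipticCurves.KrizLi2019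
  Literature.NumberTheory.QuadraticFields
  Literature.NumberTheory.GaloisRepresentations
  Literature.NumberTheory.GaloisCohomology
  Summit.BirchSwinnertonDyer.Rank1Residual
  Summit.BirchSwinnertonDyer.Rank1Residual.Additive
  Summit.BirchSwinnertonDyer.Rank1Residual.X11b
  Summit.BirchSwinnertonDyer.Rank1Residual.X11b.AcSelmer
  Summit.BirchSwinnertonDyer.Rank1Residual.X11b.Halves
  Summit.BirchSwinnertonDyer.Rank1Residual.X11b.CongruenceLimit
  Summit.BirchSwinnertonDyer.BirchSwinnertonDyer.Theses.UniversalToricDescent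
  Summit.BirchSwinnertonDyer.BirchSwinnertonDyer.Theorems.AdditivePotSupersingularControl

/-! ## §0 The Heegner twist of a (t′) row is a (t′) row (private re-homing) -/

/-- CM rank-zero rows: the UPPER half from the CM triple (row C8), any prime.
[cite: BurungaleFlach2024, Thm. 1.1 and Cor. 2 (p. 4)] -/
private theorem missingUpperBoundAt_of_hasCM_rankZero'' (hCM : bsdTriple_of_hasCM_of_L_one_ne_zero)
    (hmod : hasEntireLFunction_rat) (hGZK : rank_eq_analyticRank_of_analyticRank_le_one)
    (W : WeierstrassCurve ℚ) [W.IsElliptic] [W.IsGloballyMinimal] (p : ℕ) [Fact p.Prime]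
    (hr : W.analyticRank = 0) (hcm : W.HasCM) : MissingUpperBoundAt W p := by
  haveI : Finite W.sha := (hGZK W (by omega)).2
  exact (lower_and_upper_of_missingPPartAt W p (missingPPartAt_of_bsdp W p (bsdp_cm_rankZero hCM hmod hcm hr))).2

/-- **The Heegner twist of a (t′) row is a (t′) row** (private verbatim re-homing of
`Theorems.subTprime_twist_of_heegner`, whose module imports the KT route file): `W` globally minimal, additive of type (t′)
at `p`, `K` imaginary quadratic of ODD discriminant with the Heegner hypothesis for `N_E`; then every globally minimal
model of `E^{(d_K)}` is additive of type (t′) at `p` (`Addv`, `j`, `f_p` and `ord_p Δ_min` transport along a twist by a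
`p`-adic square unramified at `p`). [folklore] [cite: SilvermanATAEC1994, IV.9.4 (PDF pp. 344–346)]
[cite: Serre1973, Ch. II §3.3 Thm. 3] -/
private theorem subTprime_twist_of_heegner' (W : WeierstrassCurve ℚ) [W.IsElliptic] [W.IsGloballyMinimal]
    (p : ℕ) [Fact p.Prime] (hadd : Addv W p) (hT : SubTprime W p)
    (K : Type) [Field K] [NumberField K] (hK : IsImaginaryQuadratic K)
    (hHN : SatisfiesHeegnerHypothesis (W.conductorNorm ℤ) K) (hodd : Odd (NumberField.discr K))
    (Wd : WeierstrassCurve ℚ) [Wd.IsElliptic] [Wd.IsGloballyMinimal] (Cd : VariableChange ℚ)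
    (hWd : Cd • W.quadraticTwist (NumberField.discr K : ℚ) = Wd) : Addv Wd p ∧ SubTprime Wd p := by
  have hp : p.Prime := Fact.out
  have hD0 : (NumberField.discr K : ℚ) ≠ 0 := by exact_mod_cast NumberField.discr_ne_zero K
  have hpN : p ∣ W.conductorNorm ℤ :=
    (W.dvd_conductorNorm_iff_not_hasGoodReductionAtPrime p).mpr (not_good_of_addv W p hadd)
  have hsq' : IsSquare (algebraMap ℚ ℚ_[p] (NumberField.discr K : ℚ)) :=
    X11b.isSquare_discr_padic_of_heegner K hK hHN p hpN
  have hsq : IsSquare (((NumberField.discr K : ℚ) : ℚ) : ℚ_[p]) := by simpa using hsq'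
  have hj : Wd.j = W.j := AdditivePotMult.j_of_model_twist (W := W) hD0 ⟨Cd, hWd⟩
  have haddv : Addv Wd p := (AdditivePotMult.addv_iff_of_twist (W := W) hD0 hsq Wd hWd).mpr hadd
  have hpd : ¬ ((p : ℕ) : ℤ) ∣ NumberField.discr K :=
    Literature.SatisfiesHeegnerHypothesis.not_dvd_discr hK.1 hHN hp hpN
  have hd4 : NumberField.discr K % 4 = 1 :=
    Literature.NumberTheory.QuadraticFields.Quadratic.discr_emod_four_eq_one hK.1 hodd
  have hf : condExp Wd p = condExp W p := by
    unfold condExp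
    refine conductorExponent_eq_of_model_twist_of_not_dvd W Wd hd4 Cd hWd (placeOf p) ?_
    rw [natGenerator_placeOf_eq]
    exact hpd
  have hu : padicValRat p (Cd.u : ℚ) = 0 :=
    AdditivePotMult.padicValRat_u_eq_zero_of_twist_minimal_of_dvd W p K hK hHN hpN Cd hWd
  have hΔ : padicValRat p Wd.Δ = padicValRat p W.Δ := by
    haveI := W.isElliptic_quadraticTwist hD0
    have hu0 : ((Cd.u⁻¹ : ℚˣ) : ℚ) ≠ 0 := (Cd.u⁻¹).ne_zero
    have hΔ0 : W.Δ ≠ 0 := W.isUnit_Δ.ne_zero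
    have hd6 : (NumberField.discr K : ℚ) ^ 6 ≠ 0 := pow_ne_zero 6 hD0
    have hdv : padicValRat p (NumberField.discr K : ℚ) = 0 := by
      rw [padicValRat.of_int, padicValInt.eq_zero_of_not_dvd hpd, Nat.cast_zero]
    have huv : padicValRat p ((Cd.u⁻¹ : ℚˣ) : ℚ) = 0 := by
      rw [Units.val_inv_eq_inv_val, padicValRat.inv, hu, neg_zero]
    rw [← hWd, variableChange_Δ, quadraticTwist_Δ, padicValRat.mul (pow_ne_zero 12 hu0)
      (mul_ne_zero hd6 hΔ0), padicValRat.mul hd6 hΔ0, padicValRat.pow, padicValRat.pow, huv, hdv]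
    ring
  refine ⟨haddv, ?_, ?_, ?_⟩
  · unfold PotMult; rw [hj]; exact hT.1
  · unfold CondExpTwo; rw [hf]; exact hT.2.1
  · rw [semistabilityIndex_dvd_iff Wd p, ← twelve_dvd_padicValRat_Δ_iff Wd p, hΔ,
      twelve_dvd_padicValRat_Δ_iff W p, ← semistabilityIndex_dvd_iff W p]
    exact hT.2.2

section Tame

variable (p : ℕ) [Fact p.Prime] (R : WeierstrassCurve ℚ → Prop)

/-! ## §1 The twist's UPPER half on ALL irreducible (t′) rows: A161″ (tower) ∨ 19413's text (non-tower, non-CM) ∨ CM triple -/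

/-- **The Heegner twist's r = 0 UPPER half on EVERY irreducible (t′) row, tower onto or not.** For `W` globally minimal,
additive of type (t′) at the odd `p` with `ρ̄_{E,p}` irreducible, `K` a Heegner field for `N_E` with ODD discriminant, `Wd` a
globally minimal model of `E^{(d_K)}` with `L(E^{(d_K)},1) ≠ 0`: `MissingUpperBoundAt Wd p` ⟸ A161″ `hKatoT` (tower onto)
∧ the fine reading `hKatoA` + `hCS` = the TEXT of KT's aside `TameFineSelmerCoatesSujatha` (item 19413) VERBATIM (tower not
onto, `Wd` non-CM: `Wd` is again (t′), irreducible, non-tower, `r_an = 0`) ∧ the CM triple `hCM`. CONDITIONAL.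
[cite: Kato2004Asterisque, Thm. 14.5 (3) (p. 236), Prop. 14.16 (2) (p. 244)] [cite: CoatesSujatha2005, §3 (Conjecture A)]
[cite: SilvermanATAEC1994, IV.9.4 (PDF pp. 344–346)] [cite: BurungaleFlach2024, Thm. 1.1 and Cor. 2 (p. 4)] -/
theorem missingUpperBoundAt_twist_tame_of_coatesSujatha_of_kato (hp2 : p ≠ 2)
    (hKatoT : Kato2004.rankZero_padicValNat_sha_add_padicValNat_tamagawa_le_of_additive_potGood_of_imageContainsSL2)
    (hKatoA :
      Kato2004.rankZero_padicValNat_sha_add_padicValNat_tamagawa_le_of_additive_potGood_of_irreducible_of_fineSelmerDual_fg)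
    (hCM : bsdTriple_of_hasCM_of_L_one_ne_zero)
    (hGZK : rank_eq_analyticRank_of_analyticRank_le_one) (hmod : hasEntireLFunction_rat)
    (hCS : ∀ (W : WeierstrassCurve ℚ) [W.IsElliptic] [W.IsGloballyMinimal] (p : ℕ) [Fact p.Prime], W.analyticRank = 0 →
      p ≠ 2 → Addv W p → SubTprime W p → W.HasIrreducibleModPGaloisRep p → ¬ (∀ n : ℕ, W.HasSurjectiveModNGaloisRep (p ^ n : ℕ)) →
      ¬ W.HasCM → ∀ (κ : ZpExtension ℚ p), κ.IsCyclotomic → ∃ (γ : Field.absoluteGaloisGroup ℚ) (D : W.FineSelmerDualData κ γ),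
        Module.Finite ℤ_[p] (RestrictScalars ℤ_[p] (IwasawaAlgebra p) D.X))
    (W : WeierstrassCurve ℚ) [W.IsElliptic] [W.IsGloballyMinimal] (hadd : Addv W p) (hT : SubTprime W p)
    (hirr : W.HasIrreducibleModPGaloisRep p)
    {N : ℕ} (hN : W.conductorNorm ℤ = N) (K : Type) [Field K] [NumberField K] (hK : IsImaginaryQuadratic K)
    (hHN : SatisfiesHeegnerHypothesis N K) (hodd : Odd (NumberField.discr K))
    (Wd : WeierstrassCurve ℚ) [Wd.IsElliptic] [Wd.IsGloballyMinimal]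
    (hWd : ∃ C : VariableChange ℚ, C • W.quadraticTwist (NumberField.discr K : ℚ) = Wd)
    (hLd : (W.quadraticTwist (NumberField.discr K : ℚ)).entireLFunction 1 ≠ 0) : MissingUpperBoundAt Wd p := by
  have hj : 0 ≤ padicValRat p W.j := (show ClassO5 W p from ⟨hp2, hadd, Or.inr hT⟩).padicValRat_j_nonneg
  by_cases hsurj : ∀ n : ℕ, W.HasSurjectiveModNGaloisRep (p ^ n : ℕ)
  · exact missingUpperBoundAt_twist_of_towerSurj_of_katoTam p hp2 hKatoT hGZK hmod W hadd hj hsurj hN K hK hHN Wd hWd hLd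
  · have hD0 : (NumberField.discr K : ℚ) ≠ 0 := by exact_mod_cast NumberField.discr_ne_zero K
    haveI : (W.quadraticTwist (NumberField.discr K : ℚ)).IsElliptic := W.isElliptic_quadraticTwist hD0
    obtain ⟨Cd, hCd⟩ := hWd
    have hLd1 : Wd.entireLFunction 1 ≠ 0 := by rw [← hCd, entireLFunction_smul]; exact hLd
    have hrd : Wd.analyticRank = 0 := analyticRank_eq_zero_of_entireLFunction_one_ne_zero Wd hLd1
    by_cases hcm : Wd.HasCM
    · exact missingUpperBoundAt_of_hasCM_rankZero'' hCM hmod hGZK Wd p hrd hcm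
    · have hHN' : SatisfiesHeegnerHypothesis (W.conductorNorm ℤ) K := hN ▸ hHN
      obtain ⟨hadd', hT'⟩ := subTprime_twist_of_heegner' W p hadd hT K hK hHN' hodd Wd Cd hCd
      have hirrd : Wd.HasIrreducibleModPGaloisRep p := X11b.hasIrreducibleModPGaloisRep_twist_model W p K hK.1 hirr Cd hCd
      have hnsd : ¬ (∀ n : ℕ, Wd.HasSurjectiveModNGaloisRep (p ^ n : ℕ)) := fun h ↦
        hsurj fun n ↦ (GaloisImage.hasSurjectiveModNGaloisRep_pow_iff_of_model_twist W p hD0 ⟨Cd, hCd⟩ n).mp (h n)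
      exact missingUpperBoundAt_twist_of_irreducible_of_fineSelmerDual_fg p hp2 hKatoA hGZK hmod W hadd hj hirr hN K hK hHN
        Wd ⟨Cd, hCd⟩ hLd (hCS Wd p hrd hp2 hadd' hT' hirrd hnsd hcm)

/-! ## §2 KT's residual 19984 on ALL irreducible rows, in the item's own binders -/

/-- **KT's `TameRankOne` on ALL irreducible rows from the ♭-IMC equality, `TameFineSelmerCoatesSujatha` (19413) and
`TameLowerHalfRankZero` (19981), modulo print.** For any row predicate `R`, on `r_an = 1`, `p ≠ 2`, `Addv W p`,
`SubTprime W p`, `ρ̄_{E,p}` irreducible, `R W`: `BSDp W p` ⟸ `hEq` (the ♭-(∅,0)-IMC equality on the class rows — RESEARCH) ∧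
`hCS` (19413's text, at the non-tower twists) ∧ `hL0` (19981's text, at the twists — RESEARCH off the intrinsic core) ∧ A161″
∧ the fine reading ∧ the CM triple ∧ the seven cohomological facts ∧ Hsieh ∧ LZZ ∧ ToricPublishedInputs. Control:
`additiveControl_heegner_potSS_of_facts_of_serre1967` on `ClassO5`. CONDITIONAL; closes nothing; BSD_p for no curve.
[cite: JetchevSkinnerWan2017, §7.4.1 and Thm. 3.3.1 (arXiv:1512.06894)] [cite: Kato2004Asterisque, Thm. 14.5 (3), Prop. 14.16 (2)]
[cite: CoatesSujatha2005, §3 (Conjecture A)] [cite: Serre1967GroupesPDivisibles, §5 Prop. 8]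
[cite: GrossZagier1986, I.(6.3) and Thm. I.7.3] -/
theorem bsdp_tameRankOne_irreducible_of_flatIMCEq_of_coatesSujatha_of_tameLowerHalfRankZero_of_kato_of_facts
    (hA : Hsieh2014.thmA_exists_isHsiehLFunction_unrPeriod_anyLevel)
    (hL : LiuZhangZhang2018.thm151_thm153_modularCurve_heegnerVector_additive)
    (hF : ToricPublishedInputs)
    (hKatoT : Kato2004.rankZero_padicValNat_sha_add_padicValNat_tamagawa_le_of_additive_potGood_of_imageContainsSL2)
    (hKatoA :
      Kato2004.rankZero_padicValNat_sha_add_padicValNat_tamagawa_le_of_additive_potGood_of_irreducible_of_fineSelmerDual_fg)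
    (hCM : bsdTriple_of_hasCM_of_L_one_ne_zero)
    (hPT : ∀ (K : Type) [Field K] [NumberField K], poitouTate_selmerStructure_duality K)
    (hPT2 : ∀ (K : Type) [Field K] [NumberField K], poitouTate_sha_tateDual K)
    (hEP : ∀ (K : Type) [Field K] [NumberField K] (v : HeightOneSpectrum (𝓞 K)),
      localEulerPoincareCharacteristic (v.adicCompletion K))
    (hcd : fieldCdLE_two_of_numberField)
    (hBr : ∀ (K : Type) [Field K] [NumberField K] (p : ℕ) [Fact p.Prime],
      ZpExtension.decomp_not_le_kerSubgroup_of_isAnticyclotomic K p)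
    (hBr2 : ∀ (K : Type) [Field K] [NumberField K] (p : ℕ) [Fact p.Prime],
      ZpExtension.decomp_not_le_kerSubgroup_above_of_isAnticyclotomic K p)
    (hS : Serre1967.noStableDivisibleLine_of_potentiallySupersingular)
    (hCS : ∀ (W : WeierstrassCurve ℚ) [W.IsElliptic] [W.IsGloballyMinimal] (p : ℕ) [Fact p.Prime], W.analyticRank = 0 →
      p ≠ 2 → Addv W p → SubTprime W p → W.HasIrreducibleModPGaloisRep p → ¬ (∀ n : ℕ, W.HasSurjectiveModNGaloisRep (p ^ n : ℕ)) →
      ¬ W.HasCM → ∀ (κ : ZpExtension ℚ p), κ.IsCyclotomic → ∃ (γ : Field.absoluteGaloisGroup ℚ) (D : W.FineSelmerDualData κ γ),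
        Module.Finite ℤ_[p] (RestrictScalars ℤ_[p] (IwasawaAlgebra p) D.X))
    (hEq : ∀ (W : WeierstrassCurve ℚ) [W.IsElliptic] [W.IsGloballyMinimal] (N : ℕ) [NeZero N] (K : Type) [Field K]
      [NumberField K] (Dt : ModularParametrizationData W N),
      R W → Addv W p → SubTprime W p → W.HasIrreducibleModPGaloisRep p → W.analyticRank = 1 →
      W.conductorNorm ℤ = N → IsImaginaryQuadratic K → SatisfiesHeegnerHypothesis N K →
      ∀ (κ : ZpExtension K p), κ.IsAnticyclotomic → ∀ (γ : Field.absoluteGaloisGroup K) [Fact (κ.IsTopGenerator γ)]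
        (𝔭 : HeightOneSpectrum (𝓞 K)), ((p : ℕ) : 𝓞 K) ∈ 𝔭.asIdeal → 𝔭.asIdeal.ramificationIdx (𝓞 ℚ) = 1 →
        𝔭.asIdeal.inertiaDeg (𝓞 ℚ) = 1 → ∀ (𝔭' : HeightOneSpectrum (𝓞 K)), ((p : ℕ) : 𝓞 K) ∈ 𝔭'.asIdeal → 𝔭' ≠ 𝔭 →
        ∀ (ι' : PadicAlgCl p ≃+* ℂ), SchneiderFree.BranchInducesPrime p ι' 𝔭 →
        ∀ (ΩK : ℂ) (Ωp : ℂ_[p]) (Q : PowerSeries (PadicComplexInt p)), ΩK ≠ 0 → Ωp ≠ 0 →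
          R1.IsBDPLFunctionInt p ι' 𝔭 κ γ Dt.f ΩK Ωp Q →
          (XAc.charIdeal (W.baseChange K) p κ 𝔭' ∅ γ).map (PowerSeries.map (R1.toCpInt p)) = Ideal.span {Q})
    (hL0 : ∀ (W : WeierstrassCurve ℚ) [W.IsElliptic] [W.IsGloballyMinimal] (p : ℕ) [Fact p.Prime], W.analyticRank = 0 →
      p ≠ 2 → Addv W p → SubTprime W p → MissingLowerBoundAt W p) :
    ∀ (W : WeierstrassCurve ℚ) [W.IsElliptic] [W.IsGloballyMinimal], W.analyticRank = 1 → p ≠ 2 → Addv W p →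
      SubTprime W p → W.HasIrreducibleModPGaloisRep p → R W → BSDp W p := by
  intro W _ _ hr hp2 hadd hT hirr hR
  have hcls : ClassO5 W p ∨ ClassO6 W p := Or.inl ⟨hp2, hadd, Or.inr hT⟩
  have hGZK : rank_eq_analyticRank_of_analyticRank_le_one := hF.2.2.1
  have hmod : hasEntireLFunction_rat := hF.2.2.2.1
  have hKo : ∀ (N : ℕ) [NeZero N] (W : WeierstrassCurve ℚ) (K : Type) [Field K] [NumberField K],
      Literature.NumberTheory.EllipticCurves.kolyvagin N W K := hF.2.1
  have hCtl : ∀ (N : ℕ) [NeZero N] (K : Type) [Field K] [NumberField K] (Dt : ModularParametrizationData W N)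
      (H : HeegnerDatum N (NumberField.discr K)) (ι : K →+* ℂ) (P : (W.baseChange K).toAffine.Point),
      W.conductorNorm ℤ = N → IsImaginaryQuadratic K → SatisfiesHeegnerHypothesis N K →
      WeierstrassCurve.Affine.Point.map ι.toRatAlgHom P = heegnerPointComplex Dt H → ¬ IsOfFinAddOrder P →
      Literature.NumberTheory.EllipticCurves.kolyvagin N W K →
      ∀ (κ : ZpExtension K p), κ.IsAnticyclotomic → ∀ (γ : Field.absoluteGaloisGroup K) [Fact (κ.IsTopGenerator γ)]
        (𝔭 : HeightOneSpectrum (𝓞 K)) (h𝔭 : ((p : ℕ) : 𝓞 K) ∈ 𝔭.asIdeal) (he : 𝔭.asIdeal.ramificationIdx (𝓞 ℚ) = 1)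
        (hf : 𝔭.asIdeal.inertiaDeg (𝓞 ℚ) = 1), SchneiderFree.AdditiveControlOnTreeAt p κ 𝔭 γ (embAt K p 𝔭 h𝔭 he hf) P :=
    fun N _ K _ _ Dt H ι P hN hK hHN hP hnt hKo' κ hκ γ _ 𝔭 h𝔭 he hf ↦
      additiveControl_heegner_potSS_of_facts_of_serre1967 hPT hPT2 hEP hcd hBr hBr2 hS p W N K Dt H ι P hcls hirr
        hN hK hHN hP hnt hKo' κ hκ γ 𝔭 h𝔭 he hf
  refine bsdp_of_indexHalves_of_twistHalvesOdd_row p hp2 hF W hadd hr ?_ ?_ ?_ ?_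
  · intro N _ K _ _ Dt H ι P hN hK hHN _hodd hd4 _hLt hP hnt
    exact indexLowerBoundLeAt_of_flatInclLe_of_control hp2 hA hL Dt H ι P hadd hN hK hHN hd4 hP hnt (hKo N W K)
      (fun κ hκ γ _ 𝔭 h𝔭 he hf 𝔭' h𝔭' hne ι' hind ΩK Ωp Q hΩK hΩp hBDP ↦
        (hEq W N K Dt hR hadd hT hirr hr hN hK hHN κ hκ γ 𝔭 h𝔭 he hf 𝔭' h𝔭' hne ι' hind ΩK Ωp Q hΩK hΩp hBDP).le)
      (fun κ hκ γ _ 𝔭 h𝔭 he hf ↦ hCtl N K Dt H ι P hN hK hHN hP hnt (hKo N W K) κ hκ γ 𝔭 h𝔭 he hf)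
  · intro N _ K _ _ Dt H ι P hN hK hHN _hodd hd4 _hLt hP hnt
    exact indexUpperBoundLeAt_of_flatInclGe_of_control hp2 hA hL Dt H ι P hadd hN hK hHN hd4 hP hnt (hKo N W K)
      (fun κ hκ γ _ 𝔭 h𝔭 he hf 𝔭' h𝔭' hne ι' hind ΩK Ωp Q hΩK hΩp hBDP ↦
        (hEq W N K Dt hR hadd hT hirr hr hN hK hHN κ hκ γ 𝔭 h𝔭 he hf 𝔭' h𝔭' hne ι' hind ΩK Ωp Q hΩK hΩp hBDP).ge)
      (fun κ hκ γ _ 𝔭 h𝔭 he hf ↦ hCtl N K Dt H ι P hN hK hHN hP hnt (hKo N W K) κ hκ γ 𝔭 h𝔭 he hf)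
  · -- the twist's r = 0 LOWER half: KT's L₀ at `Wd`, a (t′) row of analytic rank `0`
    intro N _ K _ _ Wd _ _ hN hK hHN hodd _hd4 hC hLt
    obtain ⟨Cd, hCd⟩ := hC
    have hHN' : SatisfiesHeegnerHypothesis (W.conductorNorm ℤ) K := hN ▸ hHN
    obtain ⟨hadd', hT'⟩ := subTprime_twist_of_heegner' W p hadd hT K hK hHN' hodd Wd Cd hCd
    have hD0 : (NumberField.discr K : ℚ) ≠ 0 := by exact_mod_cast NumberField.discr_ne_zero K
    haveI : (W.quadraticTwist (NumberField.discr K : ℚ)).IsElliptic := W.isElliptic_quadraticTwist hD0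
    have hLd1 : Wd.entireLFunction 1 ≠ 0 := by rw [← hCd, entireLFunction_smul]; exact hLt
    exact hL0 Wd p (analyticRank_eq_zero_of_entireLFunction_one_ne_zero Wd hLd1) hp2 hadd' hT'
  · -- the twist's r = 0 UPPER half: §1
    intro N _ K _ _ Wd _ _ hN hK hHN hodd _hd4 hC hLt
    exact missingUpperBoundAt_twist_tame_of_coatesSujatha_of_kato p hp2 hKatoT hKatoA hCM hGZK hmod hCS W hadd hT hirr hN K hK
      hHN hodd Wd hC hLt

/-- **The same in 19984's currency `MissingPPartAt W p`** (`Ш(E/ℚ)` finite by GZK), on the binders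
`r_an = 1 → p ≠ 2 → Addv W p → SubTprime W p` of `TameRankOne` plus `ρ̄_{E,p}` irreducible and `R W`. CONDITIONAL; closes
nothing (19984 is class-wide and declared residual; this is its reduction on ALL irreducible rows to ONE analytic statement +
KT's own r = 0 items L₀ (19981) and (A) (19413)). [cite: JetchevSkinnerWan2017, §7.4.1 (arXiv:1512.06894 p. 30)]
[cite: Kato2004Asterisque, Thm. 14.5 (3), Prop. 14.16 (2)] [cite: CoatesSujatha2005, §3 (Conjecture A)] -/
theorem missingPPartAt_tameRankOne_irreducible_of_flatIMCEq_of_coatesSujatha_of_tameLowerHalfRankZero_of_kato_of_facts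
    (hA : Hsieh2014.thmA_exists_isHsiehLFunction_unrPeriod_anyLevel)
    (hL : LiuZhangZhang2018.thm151_thm153_modularCurve_heegnerVector_additive)
    (hF : ToricPublishedInputs)
    (hKatoT : Kato2004.rankZero_padicValNat_sha_add_padicValNat_tamagawa_le_of_additive_potGood_of_imageContainsSL2)
    (hKatoA :
      Kato2004.rankZero_padicValNat_sha_add_padicValNat_tamagawa_le_of_additive_potGood_of_irreducible_of_fineSelmerDual_fg)
    (hCM : bsdTriple_of_hasCM_of_L_one_ne_zero)
    (hPT : ∀ (K : Type) [Field K] [NumberField K], poitouTate_selmerStructure_duality K)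
    (hPT2 : ∀ (K : Type) [Field K] [NumberField K], poitouTate_sha_tateDual K)
    (hEP : ∀ (K : Type) [Field K] [NumberField K] (v : HeightOneSpectrum (𝓞 K)),
      localEulerPoincareCharacteristic (v.adicCompletion K))
    (hcd : fieldCdLE_two_of_numberField)
    (hBr : ∀ (K : Type) [Field K] [NumberField K] (p : ℕ) [Fact p.Prime],
      ZpExtension.decomp_not_le_kerSubgroup_of_isAnticyclotomic K p)
    (hBr2 : ∀ (K : Type) [Field K] [NumberField K] (p : ℕ) [Fact p.Prime],
      ZpExtension.decomp_not_le_kerSubgroup_above_of_isAnticyclotomic K p)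
    (hS : Serre1967.noStableDivisibleLine_of_potentiallySupersingular)
    (hCS : ∀ (W : WeierstrassCurve ℚ) [W.IsElliptic] [W.IsGloballyMinimal] (p : ℕ) [Fact p.Prime], W.analyticRank = 0 →
      p ≠ 2 → Addv W p → SubTprime W p → W.HasIrreducibleModPGaloisRep p → ¬ (∀ n : ℕ, W.HasSurjectiveModNGaloisRep (p ^ n : ℕ)) →
      ¬ W.HasCM → ∀ (κ : ZpExtension ℚ p), κ.IsCyclotomic → ∃ (γ : Field.absoluteGaloisGroup ℚ) (D : W.FineSelmerDualData κ γ),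
        Module.Finite ℤ_[p] (RestrictScalars ℤ_[p] (IwasawaAlgebra p) D.X))
    (hEq : ∀ (W : WeierstrassCurve ℚ) [W.IsElliptic] [W.IsGloballyMinimal] (N : ℕ) [NeZero N] (K : Type) [Field K]
      [NumberField K] (Dt : ModularParametrizationData W N),
      R W → Addv W p → SubTprime W p → W.HasIrreducibleModPGaloisRep p → W.analyticRank = 1 →
      W.conductorNorm ℤ = N → IsImaginaryQuadratic K → SatisfiesHeegnerHypothesis N K →
      ∀ (κ : ZpExtension K p), κ.IsAnticyclotomic → ∀ (γ : Field.absoluteGaloisGroup K) [Fact (κ.IsTopGenerator γ)]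
        (𝔭 : HeightOneSpectrum (𝓞 K)), ((p : ℕ) : 𝓞 K) ∈ 𝔭.asIdeal → 𝔭.asIdeal.ramificationIdx (𝓞 ℚ) = 1 →
        𝔭.asIdeal.inertiaDeg (𝓞 ℚ) = 1 → ∀ (𝔭' : HeightOneSpectrum (𝓞 K)), ((p : ℕ) : 𝓞 K) ∈ 𝔭'.asIdeal → 𝔭' ≠ 𝔭 →
        ∀ (ι' : PadicAlgCl p ≃+* ℂ), SchneiderFree.BranchInducesPrime p ι' 𝔭 →
        ∀ (ΩK : ℂ) (Ωp : ℂ_[p]) (Q : PowerSeries (PadicComplexInt p)), ΩK ≠ 0 → Ωp ≠ 0 →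
          R1.IsBDPLFunctionInt p ι' 𝔭 κ γ Dt.f ΩK Ωp Q →
          (XAc.charIdeal (W.baseChange K) p κ 𝔭' ∅ γ).map (PowerSeries.map (R1.toCpInt p)) = Ideal.span {Q})
    (hL0 : ∀ (W : WeierstrassCurve ℚ) [W.IsElliptic] [W.IsGloballyMinimal] (p : ℕ) [Fact p.Prime], W.analyticRank = 0 →
      p ≠ 2 → Addv W p → SubTprime W p → MissingLowerBoundAt W p) :
    ∀ (W : WeierstrassCurve ℚ) [W.IsElliptic] [W.IsGloballyMinimal], W.analyticRank = 1 → p ≠ 2 → Addv W p →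
      SubTprime W p → W.HasIrreducibleModPGaloisRep p → R W → MissingPPartAt W p := by
  intro W _ _ hr hp2 hadd hT hirr hR
  have hGZK : rank_eq_analyticRank_of_analyticRank_le_one := hF.2.2.1
  haveI : Finite W.sha := (hGZK W (by omega)).2
  exact missingPPartAt_of_bsdp W p
    (bsdp_tameRankOne_irreducible_of_flatIMCEq_of_coatesSujatha_of_tameLowerHalfRankZero_of_kato_of_facts p R hA hL hF hKatoT
      hKatoA hCM hPT hPT2 hEP hcd hBr hBr2 hS hCS hEq hL0 W hr hp2 hadd hT hirr hR)

end Tame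

section WildThree

variable [Fact (3 : ℕ).Prime] (R : WeierstrassCurve ℚ → Prop)

/-! ## §3 K9's 19200 in its own currency -/

/-- **The same in 19200's currency `MissingPPartAt W 3`** (`Ш(E/ℚ)` finite by GZK). CONDITIONAL; closes nothing (19200 is
class-wide and declared residual; this is its reduction on ALL irreducible rows to ONE analytic statement + K9's own r = 0
items L₀ (19195) and (A) (19386)). [cite: JetchevSkinnerWan2017, §7.4.1 (arXiv:1512.06894 p. 30)]
[cite: Kato2004Asterisque, Thm. 14.5 (3), Prop. 14.16 (2)] [cite: CoatesSujatha2005, §3 (Conjecture A)] -/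
theorem missingPPartAt_wildRankOne_irreducible_of_flatIMCEq_of_coatesSujatha_of_wildLowerHalfRankZero_of_kato_of_facts
    (hA : Hsieh2014.thmA_exists_isHsiehLFunction_unrPeriod_anyLevel)
    (hL : LiuZhangZhang2018.thm151_thm153_modularCurve_heegnerVector_additive)
    (hF : ToricPublishedInputs)
    (hKatoT : Kato2004.rankZero_padicValNat_sha_add_padicValNat_tamagawa_le_of_additive_potGood_of_imageContainsSL2)
    (hKatoA :
      Kato2004.rankZero_padicValNat_sha_add_padicValNat_tamagawa_le_of_additive_potGood_of_irreducible_of_fineSelmerDual_fg)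
    (hCM : bsdTriple_of_hasCM_of_L_one_ne_zero)
    (hPT : ∀ (K : Type) [Field K] [NumberField K], poitouTate_selmerStructure_duality K)
    (hPT2 : ∀ (K : Type) [Field K] [NumberField K], poitouTate_sha_tateDual K)
    (hEP : ∀ (K : Type) [Field K] [NumberField K] (v : HeightOneSpectrum (𝓞 K)),
      localEulerPoincareCharacteristic (v.adicCompletion K))
    (hcd : fieldCdLE_two_of_numberField)
    (hBr : ∀ (K : Type) [Field K] [NumberField K] (p : ℕ) [Fact p.Prime],
      ZpExtension.decomp_not_le_kerSubgroup_of_isAnticyclotomic K p)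
    (hBr2 : ∀ (K : Type) [Field K] [NumberField K] (p : ℕ) [Fact p.Prime],
      ZpExtension.decomp_not_le_kerSubgroup_above_of_isAnticyclotomic K p)
    (hS : Serre1967.noStableDivisibleLine_of_potentiallySupersingular)
    (hCS : ∀ (W : WeierstrassCurve ℚ) [W.IsElliptic] [W.IsGloballyMinimal] [Fact (3 : ℕ).Prime], W.analyticRank = 0 →
      ClassO6 W 3 → W.HasIrreducibleModPGaloisRep 3 → ¬ (∀ n : ℕ, W.HasSurjectiveModNGaloisRep (3 ^ n : ℕ)) → ¬ W.HasCM →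
      ∀ (κ : ZpExtension ℚ 3), κ.IsCyclotomic → ∃ (γ : Field.absoluteGaloisGroup ℚ) (D : W.FineSelmerDualData κ γ),
        Module.Finite ℤ_[3] (RestrictScalars ℤ_[3] (IwasawaAlgebra 3) D.X))
    (hEq : ∀ (W : WeierstrassCurve ℚ) [W.IsElliptic] [W.IsGloballyMinimal] (N : ℕ) [NeZero N] (K : Type) [Field K]
      [NumberField K] (Dt : ModularParametrizationData W N),
      R W → ClassO6 W 3 → W.HasIrreducibleModPGaloisRep 3 → W.analyticRank = 1 →
      W.conductorNorm ℤ = N → IsImaginaryQuadratic K → SatisfiesHeegnerHypothesis N K →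
      ∀ (κ : ZpExtension K 3), κ.IsAnticyclotomic → ∀ (γ : Field.absoluteGaloisGroup K) [Fact (κ.IsTopGenerator γ)]
        (𝔭 : HeightOneSpectrum (𝓞 K)), ((3 : ℕ) : 𝓞 K) ∈ 𝔭.asIdeal → 𝔭.asIdeal.ramificationIdx (𝓞 ℚ) = 1 →
        𝔭.asIdeal.inertiaDeg (𝓞 ℚ) = 1 → ∀ (𝔭' : HeightOneSpectrum (𝓞 K)), ((3 : ℕ) : 𝓞 K) ∈ 𝔭'.asIdeal → 𝔭' ≠ 𝔭 →
        ∀ (ι' : PadicAlgCl 3 ≃+* ℂ), SchneiderFree.BranchInducesPrime 3 ι' 𝔭 →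
        ∀ (ΩK : ℂ) (Ωp : ℂ_[3]) (Q : PowerSeries (PadicComplexInt 3)), ΩK ≠ 0 → Ωp ≠ 0 →
          R1.IsBDPLFunctionInt 3 ι' 𝔭 κ γ Dt.f ΩK Ωp Q →
          (XAc.charIdeal (W.baseChange K) 3 κ 𝔭' ∅ γ).map (PowerSeries.map (R1.toCpInt 3)) = Ideal.span {Q})
    (hL0 : ∀ (W : WeierstrassCurve ℚ) [W.IsElliptic] [W.IsGloballyMinimal] [Fact (3 : ℕ).Prime], W.analyticRank = 0 →
      ClassO6 W 3 → MissingLowerBoundAt W 3) :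
    ∀ (W : WeierstrassCurve ℚ) [W.IsElliptic] [W.IsGloballyMinimal], W.analyticRank = 1 → ClassO6 W 3 →
      W.HasIrreducibleModPGaloisRep 3 → R W → MissingPPartAt W 3 := by
  intro W _ _ hr hO6 hirr hR
  have hGZK : rank_eq_analyticRank_of_analyticRank_le_one := hF.2.2.1
  haveI : Finite W.sha := (hGZK W (by omega)).2
  exact missingPPartAt_of_bsdp W 3
    (bsdp_wildRankOne_irreducible_of_flatIMCEq_of_coatesSujatha_of_wildLowerHalfRankZero_of_kato_of_facts R hA hL hF hKatoT
      hKatoA hCM hPT hPT2 hEP hcd hBr hBr2 hS hCS hEq hL0 W hr hO6 hirr hR)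

end WildThree

end Summit.BirchSwinnertonDyer.BirchSwinnertonDyer.Theorems.UniversalToricDescentWaldspurgerFlat

end
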